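import Mathlib.NumberTheory.Chebyshev
import Mathlib.NumberTheory.Padics.PadicVal.Basic
import Mathlib.Analysis.SpecificLimits.Basic
import Mathlib.Data.Int.Interval
import Mathlib.Data.Nat.Factorization.Basic
import Literature.NumberTheory.Transcendental.ZetaLinearFormsCriterion
import HarnessLib

/-!
# Fischler's lcm lemma for products of distinct integers (Fischler 2026, Lemma 2)

Topic `Literature/NumberTheory/Irrationality/Fischler2026`. S. Fischler, *Linear independence of odd
zeta values using Siegel's lemma*, J. London Math. Soc. (2) **113** (2026), doi:10.1112/jlms.70535 =
arXiv:2109.10136 [Fischler2026], §3.3 "A lemma from analytic number theory" (PRIMARY SOURCE read on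
the page, held `paper:arxiv-2109.10136`, arXiv pp. 7–8):

"**Lemma 2.** Let `a, N ≥ 1`. Denote by `Δ_{a,N}` the least common multiple of all products
`N₁⋯N_ℓ` where `ℓ ≤ a` and `N₁, …, N_ℓ` are pairwise distinct integers between `-N` and `N` such
that `max N_i - min N_i ≤ N`. Then as `N → ∞` (while `a` is fixed) we have:
`Δ_{a,N} = exp(N(∑_{j=1}^a 1/j + o(1))) ≤ ((a+1) e^{γ+o(1)})^N` where `γ` is Euler's constant."
"The naive version of this lemma would be to use the upper bound `Δ_{a,N} ≤ d_N^a`, where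
`d_N = lcm(1,2,…,N)`, leading to `Δ_{a,N} ≤ e^{Na+o(N)}`. The dependence in `a` is much better in
Lemma 2 because we use the assumption that `N₁, …, N_ℓ` are pairwise distinct."
Printed proof: with `f_{a,N}(p^e) = min(a, ⌊N/p^e⌋)` and `Δ := ∏_{p^e ≤ N} p^{f_{a,N}(p^e)}`,
(i) `Δ_{a,N} ∣ Δ`: for NON-ZERO pairwise distinct `N_i` as above and `e ≥ 1`, the number of `i`
with `p^e ∣ N_i` is `≤ ℓ ≤ a` and `≤ ⌊N/p^e⌋` ("since all `N_i` are non-zero"); (ii) `Δ ∣ Δ_{a,N}`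
by an explicit admissible choice of `N_i ∈ [1, N]` for each prime `p`; (iii)
`log Δ = ∑_{k=1}^a ψ(N/k) = N(∑_{k=1}^a 1/k + o(1))` by the prime number theorem.

RENDERING. We DEFINE `Delta a N` by the closed form of step (iii),
`Δ_{a,N} = ∏_{k=1}^{a} d_{⌊N/k⌋}` (`d_M = Nat.lcmUpto M`, `log d_M = ψ(M)`), and PROVE
* `padicValNat_Delta` — the displayed formula `v_p(Δ) = ∑_{e=1}^{⌊log_p N⌋} min(a, ⌊N/p^e⌋)`;
* `prod_dvd_Delta` — step (i): every product of at most `a` pairwise distinct NON-ZERO integers of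
  `[-N, N]` with `max - min ≤ N` divides `Δ_{a,N}` (the products in the printed lcm are over
  non-zero `N_i`, as the proof makes explicit; a zero factor would only contribute the product `0`);
  this is the direction used in [Fischler2026, Prop. 2];
* `exists_prod_padicValNat_eq` and `Delta_dvd_of_forall_prod_dvd` — step (ii): for every prime `p`
  an admissible product of integers of `[1, N]` has the full `p`-adic valuation of `Δ_{a,N}`, hence
  `Δ_{a,N}` divides every common multiple of the admissible products; with `prod_dvd_Delta` this says
  that `Delta a N` IS the printed least common multiple;
* `tendsto_log_Delta_div` — step (iii): `(log Δ_{a,N})/N → ∑_{k=1}^a 1/k` (prime number theorem, the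
  tree's `Literature.NumberTheory.Transcendental.tendsto_log_lcmUpto_div`).
-- TODO(general form): the closing printed inequality `∑_{k≤a} 1/k ≤ γ + log(a+1)` (monotonicity of
-- `H_a - log(a+1)`) is not transcribed.
Everything here is PROVED (no named facts).

Cell zeta5-irr (HONEST FRAMING: systematic search; no irrationality claim unless certified): typed at
the request of the cell's denominator desk (toolkit item 'DistinctProductLcm'); the lemma is the
arithmetic of Fischler's non-explicit (Siegel-lemma) linear forms; it gives no saving for powers of
hypergeometric bricks, whose Taylor coefficients have repeated factors.
-/

noncomputable section

open Finset Filter Topology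

namespace Literature.NumberTheory.Irrationality.Fischler2026

/-! ### Definition and `p`-adic valuation -/

/-- Fischler's `Δ_{a,N}`, in the closed form `Δ_{a,N} = ∏_{k=1}^{a} d_{⌊N/k⌋}`, `d_M = lcm(1, …, M)`
(equivalently `log Δ_{a,N} = ∑_{k=1}^{a} ψ(N/k)`).
[cite: Fischler2026, §3.3 Lemma 2 and its proof (arXiv p. 8: `log Δ = ∑_{k=1}^a ψ(N/k)`)] -/
def Delta (a N : ℕ) : ℕ := ∏ k ∈ Icc 1 a, Nat.lcmUpto (N / k)

/-- `Δ_{a,N} > 0`. [cite: Fischler2026, §3.3 Lemma 2] -/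
theorem Delta_pos (a N : ℕ) : 0 < Delta a N :=
  prod_pos fun _ _ => Nat.lcmUpto_pos _

/-- `Δ_{a,N} ≠ 0`. [cite: Fischler2026, §3.3 Lemma 2] -/
theorem Delta_ne_zero (a N : ℕ) : Delta a N ≠ 0 := (Delta_pos a N).ne'

/-- `v_p(d_M) = ⌊log_p M⌋`. [folklore] -/
private theorem padicValNat_lcmUpto (p M : ℕ) [hp : Fact p.Prime] :
    padicValNat p (Nat.lcmUpto M) = Nat.log p M := by
  rw [← Nat.factorization_def _ hp.out, Nat.factorization_lcmUpto M hp.out]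

/-- `#{k ∈ [1, a] : k ≤ M} = min(a, M)`. [folklore] -/
private theorem card_filter_Icc_le (a M : ℕ) :
    ((Icc 1 a).filter (fun k => k ≤ M)).card = min a M := by
  have h : (Icc 1 a).filter (fun k => k ≤ M) = Icc 1 (min a M) := by
    ext k
    simp only [mem_filter, mem_Icc, le_min_iff]
    tauto
  rw [h, Nat.card_Icc]
  omega

/-- `⌊log_p m⌋ = #{e ∈ [1, L] : p^e ≤ m}` whenever `⌊log_p m⌋ ≤ L` (`p ≥ 2`). [folklore] -/
private theorem log_eq_card_filter {p : ℕ} (hp : 1 < p) {m L : ℕ} (hmL : Nat.log p m ≤ L) :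
    Nat.log p m = ((Icc 1 L).filter (fun e => p ^ e ≤ m)).card := by
  rcases eq_or_ne m 0 with rfl | hm
  · have h : (Icc 1 L).filter (fun e => p ^ e ≤ 0) = ∅ :=
      filter_eq_empty_iff.mpr fun e _ => not_le.mpr (Nat.pow_pos (by omega))
    rw [h, card_empty, Nat.log_zero_right]
  · have h : (Icc 1 L).filter (fun e => p ^ e ≤ m) = Icc 1 (Nat.log p m) := by
      ext e
      simp only [mem_filter, mem_Icc, ← Nat.le_log_iff_pow_le hp hm]
      constructor
      · rintro ⟨⟨h1, -⟩, h2⟩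
        exact ⟨h1, h2⟩
      · rintro ⟨h1, h2⟩
        exact ⟨⟨h1, h2.trans hmL⟩, h2⟩
    rw [h, Nat.card_Icc]
    omega

/-- **Fischler's formula** `v_p(Δ_{a,N}) = ∑_{e=1}^{⌊log_p N⌋} min(a, ⌊N/p^e⌋) = ∑_e f_{a,N}(p^e)`.
[cite: Fischler2026, §3.3 proof of Lemma 2, the display for `v_p(Δ)` (arXiv p. 7)] -/
theorem padicValNat_Delta (p : ℕ) [hp : Fact p.Prime] (a N : ℕ) :
    padicValNat p (Delta a N) = ∑ e ∈ Icc 1 (Nat.log p N), min a (N / p ^ e) := by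
  have hp1 : 1 < p := hp.out.one_lt
  -- `v_p(∏_k d_{⌊N/k⌋}) = ∑_k ⌊log_p ⌊N/k⌋⌋`
  have h1 : padicValNat p (Delta a N) = ∑ k ∈ Icc 1 a, Nat.log p (N / k) := by
    unfold Delta
    rw [← Nat.factorization_def _ hp.out,
      Nat.factorization_prod fun k _ => Nat.lcmUpto_ne_zero _, Finsupp.finsetSum_apply]
    exact sum_congr rfl fun k _ => by
      rw [Nat.factorization_def _ hp.out, padicValNat_lcmUpto]
  -- double counting of `{(k, e) : 1 ≤ k ≤ a, 1 ≤ e, k p^e ≤ N}`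
  have h2 : ∀ k ∈ Icc 1 a, Nat.log p (N / k) =
      ∑ e ∈ Icc 1 (Nat.log p N), if k * p ^ e ≤ N then 1 else 0 := by
    intro k hk
    have hk1 : 0 < k := (mem_Icc.1 hk).1
    rw [log_eq_card_filter hp1 (Nat.log_mono_right (Nat.div_le_self N k)), card_filter]
    refine sum_congr rfl fun e _ => ?_
    simp only [Nat.le_div_iff_mul_le hk1, mul_comm k]
  have h3 : ∀ e ∈ Icc 1 (Nat.log p N), min a (N / p ^ e) =
      ∑ k ∈ Icc 1 a, if k * p ^ e ≤ N then 1 else 0 := by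
    intro e _
    rw [← card_filter_Icc_le, card_filter]
    refine sum_congr rfl fun k _ => ?_
    simp only [Nat.le_div_iff_mul_le (Nat.pow_pos hp.out.pos)]
  rw [h1, sum_congr rfl h2, sum_comm, sum_congr rfl h3]

/-! ### Counting non-zero multiples in a window -/

/-- Non-zero multiples of `q ≥ 1` among integers of absolute value `≤ N` and spread `≤ N`: there are
at most `⌊N/q⌋` of them (dividing by `q` and adjoining `0` gives distinct integers in a window of
length `⌊N/q⌋`). [cite: Fischler2026, §3.3 proof of Lemma 2 ("since all N_i are non-zero, we obtain
Card S_e ≤ ⌊N/p^e⌋", arXiv p. 7)] -/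
theorem card_multiples_le {N q : ℕ} (hq : 0 < q) {T : Finset ℤ} (h0 : (0 : ℤ) ∉ T)
    (hdvd : ∀ x ∈ T, (q : ℤ) ∣ x) (hN : ∀ x ∈ T, |x| ≤ (N : ℤ))
    (hsp : ∀ x ∈ T, ∀ y ∈ T, x - y ≤ (N : ℤ)) : T.card ≤ N / q := by
  set m : ℕ := N / q with hm_def
  have hqz : (0 : ℤ) < q := by exact_mod_cast hq
  have hmz : ((N : ℤ) / (q : ℤ)) = (m : ℤ) := by rw [hm_def, Int.natCast_div]
  -- the quotients `x / q`
  let U : Finset ℤ := T.image (fun x => x / (q : ℤ))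
  have hU : U.card = T.card := by
    refine card_image_of_injOn fun x hx y hy hxy => ?_
    have hx' := hdvd x hx
    have hy' := hdvd y hy
    rw [← Int.ediv_mul_cancel hx', ← Int.ediv_mul_cancel hy', hxy]
  have hU0 : (0 : ℤ) ∉ U := by
    intro h
    obtain ⟨x, hx, hx0⟩ := mem_image.1 h
    have := Int.ediv_mul_cancel (hdvd x hx)
    rw [hx0, zero_mul] at this
    rw [← this] at hx
    exact h0 hx
  have hUabs : ∀ y ∈ U, |y| ≤ (m : ℤ) := by
    intro y hy
    obtain ⟨x, hx, rfl⟩ := mem_image.1 hy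
    rw [← hmz]
    refine Int.le_ediv_of_mul_le hqz ?_
    have h1 : |x / (q : ℤ)| * (q : ℤ) = |x| := by
      conv_rhs => rw [← Int.ediv_mul_cancel (hdvd x hx)]
      rw [abs_mul, abs_of_pos hqz]
    rw [h1]
    exact hN x hx
  have hUsp : ∀ y ∈ U, ∀ y' ∈ U, y - y' ≤ (m : ℤ) := by
    intro y hy y' hy'
    obtain ⟨x, hx, rfl⟩ := mem_image.1 hy
    obtain ⟨x', hx', rfl⟩ := mem_image.1 hy'
    rw [← hmz]
    refine Int.le_ediv_of_mul_le hqz ?_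
    rw [sub_mul, Int.ediv_mul_cancel (hdvd x hx), Int.ediv_mul_cancel (hdvd x' hx')]
    exact hsp x hx x' hx'
  rw [← hU]
  rcases U.eq_empty_or_nonempty with hUe | hne
  · simp [hUe]
  -- `insert 0 U ⊆ [v, v + m]` with `v = min (min U) 0`
  set u : ℤ := U.min' hne with hu_def
  have hu : u ∈ U := min'_mem U hne
  set v : ℤ := min u 0 with hv_def
  have hum : -(m : ℤ) ≤ u := (abs_le.1 (hUabs u hu)).1
  have hsub : insert (0 : ℤ) U ⊆ Icc v (v + m) := by
    intro y hy
    rw [mem_Icc]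
    rcases mem_insert.1 hy with rfl | hyU
    · refine ⟨min_le_right _ _, ?_⟩
      have : -(m : ℤ) ≤ v := le_min hum (by simp)
      linarith
    · refine ⟨(min_le_left _ _).trans (min'_le U y hyU), ?_⟩
      rw [hv_def, ← min_add_add_right, zero_add]
      exact le_min (by linarith [hUsp y hyU u hu]) (abs_le.1 (hUabs y hyU)).2
  have hcard := card_le_card hsub
  rw [card_insert_of_notMem hU0, Int.card_Icc] at hcard
  have h3 : (v + (m : ℤ) + 1 - v).toNat = m + 1 := by
    have : v + (m : ℤ) + 1 - v = ((m + 1 : ℕ) : ℤ) := by push_cast; ring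
    rw [this]
    simp
  rw [h3] at hcard
  omega

/-- `∑_{x ∈ S} v_p(|x|) = ∑_{e=1}^{⌊log_p N⌋} #{x ∈ S : p^e ∣ x}` for a set `S` of non-zero integers of
absolute value `≤ N`. [cite: Fischler2026, §3.3 proof of Lemma 2, display (v_p(N₁⋯N_ℓ) = ∑_e Card S_e)] -/
theorem sum_padicValNat_natAbs_eq {p : ℕ} [hp : Fact p.Prime] {N : ℕ} {S : Finset ℤ}
    (hS : ∀ x ∈ S, x ≠ 0 ∧ |x| ≤ (N : ℤ)) :
    ∑ x ∈ S, padicValNat p x.natAbs =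
      ∑ e ∈ Icc 1 (Nat.log p N), (S.filter (fun x => ((p ^ e : ℕ) : ℤ) ∣ x)).card := by
  have key : ∀ x ∈ S, padicValNat p x.natAbs =
      ∑ e ∈ Icc 1 (Nat.log p N), if ((p ^ e : ℕ) : ℤ) ∣ x then 1 else 0 := by
    intro x hx
    obtain ⟨hx0, hxN⟩ := hS x hx
    have hx0' : x.natAbs ≠ 0 := Int.natAbs_ne_zero.2 hx0
    have hxN' : x.natAbs ≤ N := by
      rw [Int.abs_eq_natAbs] at hxN
      exact_mod_cast hxN
    have hvL : padicValNat p x.natAbs ≤ Nat.log p N := by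
      have hN0 : N ≠ 0 := by omega
      rw [Nat.le_log_iff_pow_le hp.out.one_lt hN0]
      exact (Nat.le_of_dvd (Nat.pos_of_ne_zero hx0') pow_padicValNat_dvd).trans hxN'
    have hset : (Icc 1 (Nat.log p N)).filter (fun e => ((p ^ e : ℕ) : ℤ) ∣ x) =
        Icc 1 (padicValNat p x.natAbs) := by
      ext e
      simp only [mem_filter, mem_Icc, Int.natCast_dvd, padicValNat_dvd_iff_le hx0']
      constructor
      · rintro ⟨⟨h1, -⟩, h2⟩
        exact ⟨h1, h2⟩
      · rintro ⟨h1, h2⟩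
        exact ⟨⟨h1, h2.trans hvL⟩, h2⟩
    rw [← card_filter, hset, Nat.card_Icc]
    omega
  rw [sum_congr rfl key, sum_comm]
  exact sum_congr rfl fun e _ => (card_filter _ _).symm

/-- `v_p` of the absolute value of a product of non-zero integers is the sum of the `v_p`.
[folklore] -/
private theorem padicValNat_natAbs_prod {p : ℕ} [hp : Fact p.Prime] {S : Finset ℤ}
    (hS : ∀ x ∈ S, x ≠ 0) :
    padicValNat p (∏ x ∈ S, x).natAbs = ∑ x ∈ S, padicValNat p x.natAbs := by
  have hprod : (∏ x ∈ S, x).natAbs = ∏ x ∈ S, x.natAbs := map_prod Int.natAbsHom _ _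
  have hne : ∀ x ∈ S, x.natAbs ≠ 0 := fun x hx => Int.natAbs_ne_zero.2 (hS x hx)
  rw [hprod, ← Nat.factorization_def _ hp.out, Nat.factorization_prod hne,
    Finsupp.finsetSum_apply]
  exact sum_congr rfl fun x _ => Nat.factorization_def _ hp.out

/-! ### Every admissible product divides `Δ_{a,N}` -/

/-- **Fischler 2026, Lemma 2 — divisibility** (the half used in [Fischler2026, Prop. 2]): every
product of at most `a` pairwise distinct non-zero integers `N_i ∈ [-N, N]` with
`max N_i - min N_i ≤ N` divides `Δ_{a,N}`.
[cite: Fischler2026, §3.3 Lemma 2, proof step "Δ_{a,N} divides Δ" (arXiv p. 7)] -/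
theorem prod_dvd_Delta {a N : ℕ} {S : Finset ℤ} (hcard : S.card ≤ a) (h0 : (0 : ℤ) ∉ S)
    (hN : ∀ x ∈ S, |x| ≤ (N : ℤ)) (hsp : ∀ x ∈ S, ∀ y ∈ S, x - y ≤ (N : ℤ)) :
    (∏ x ∈ S, x) ∣ (Delta a N : ℤ) := by
  have hS0 : ∀ x ∈ S, x ≠ 0 := fun x hx h => h0 (h ▸ hx)
  have hP0 : (∏ x ∈ S, x).natAbs ≠ 0 :=
    Int.natAbs_ne_zero.2 (prod_ne_zero_iff.2 hS0)
  rw [← Int.natAbs_dvd_natAbs, Int.natAbs_natCast]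
  refine (Nat.factorization_prime_le_iff_dvd hP0 (Delta_ne_zero a N)).1 fun p hp => ?_
  haveI := Fact.mk hp
  rw [Nat.factorization_def _ hp, Nat.factorization_def _ hp, padicValNat_Delta,
    padicValNat_natAbs_prod hS0, sum_padicValNat_natAbs_eq fun x hx => ⟨hS0 x hx, hN x hx⟩]
  refine sum_le_sum fun e he => le_min ((card_filter_le _ _).trans hcard) ?_
  have hpe : 0 < p ^ e := Nat.pow_pos hp.pos
  refine card_multiples_le hpe (fun h => h0 (mem_filter.1 h).1) (fun x hx => ?_)
    (fun x hx => hN x (mem_filter.1 hx).1)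
    (fun x hx y hy => hsp x (mem_filter.1 hx).1 y (mem_filter.1 hy).1)
  exact_mod_cast (mem_filter.1 hx).2

/-! ### Sharpness: an admissible product with the full `p`-adic valuation -/

/-- `#{x ∈ [1, N] : q ∣ x} = ⌊N/q⌋`. [folklore] -/
private theorem card_filter_Icc_dvd (N q : ℕ) : ((Icc 1 N).filter (fun x => q ∣ x)).card = N / q := by
  have h : Icc 1 N = Ioc 0 N := by
    ext x
    simp only [mem_Icc, mem_Ioc]
    omega
  rw [h]
  exact Nat.Ioc_filter_dvd_card_eq_div N q

/-- `∑_{x ∈ S} v_p(x) = ∑_{e=1}^{⌊log_p N⌋} #{x ∈ S : p^e ∣ x}` for a set `S` of non-zero naturals `≤ N`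
(the counting identity of the printed proof, for subsets of `[1, N]`).
[cite: Fischler2026, §3.3 proof of Lemma 2, display (v_p(N₁⋯N_ℓ) = ∑_e Card S_e) (arXiv p. 7)] -/
theorem sum_padicValNat_eq {p : ℕ} [hp : Fact p.Prime] {N : ℕ} {S : Finset ℕ}
    (hS : ∀ x ∈ S, x ≠ 0 ∧ x ≤ N) :
    ∑ x ∈ S, padicValNat p x =
      ∑ e ∈ Icc 1 (Nat.log p N), (S.filter (fun x => p ^ e ∣ x)).card := by
  have key : ∀ x ∈ S, padicValNat p x =
      ∑ e ∈ Icc 1 (Nat.log p N), if p ^ e ∣ x then 1 else 0 := by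
    intro x hx
    obtain ⟨hx0, hxN⟩ := hS x hx
    have hvL : padicValNat p x ≤ Nat.log p N := by
      have hN0 : N ≠ 0 := by omega
      rw [Nat.le_log_iff_pow_le hp.out.one_lt hN0]
      exact (Nat.le_of_dvd (Nat.pos_of_ne_zero hx0) pow_padicValNat_dvd).trans hxN
    have hset : (Icc 1 (Nat.log p N)).filter (fun e => p ^ e ∣ x) =
        Icc 1 (padicValNat p x) := by
      ext e
      simp only [mem_filter, mem_Icc, padicValNat_dvd_iff_le hx0]
      constructor
      · rintro ⟨⟨h1, -⟩, h2⟩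
        exact ⟨h1, h2⟩
      · rintro ⟨h1, h2⟩
        exact ⟨⟨h1, h2.trans hvL⟩, h2⟩
    rw [← card_filter, hset, Nat.card_Icc]
    omega
  rw [sum_congr rfl key, sum_comm]
  exact sum_congr rfl fun e _ => (card_filter _ _).symm

/-- For every prime `p` there are at most `a` distinct integers in `[1, N]` whose `p`-adic valuations
add up to `v_p(Δ_{a,N}) = ∑_e min(a, ⌊N/p^e⌋)`: all multiples of `p^E` for the least `E` with
`⌊N/p^E⌋ ≤ a`, topped up with integers of valuation exactly `E - 1`.
[cite: Fischler2026, §3.3 proof of Lemma 2, step "Δ divides Δ_{a,N}" (arXiv p. 8)] -/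
theorem exists_sum_padicValNat_eq (p : ℕ) [hp : Fact p.Prime] (a N : ℕ) :
    ∃ S : Finset ℕ, S.card ≤ a ∧ S ⊆ Icc 1 N ∧
      ∑ x ∈ S, padicValNat p x = ∑ e ∈ Icc 1 (Nat.log p N), min a (N / p ^ e) := by
  have hp1 : 1 < p := hp.out.one_lt
  have hIcc : ∀ x ∈ Icc 1 N, x ≠ 0 ∧ x ≤ N := fun x hx => by
    have := mem_Icc.1 hx
    exact ⟨by omega, this.2⟩
  by_cases hNa : N ≤ a
  · -- all of `[1, N]`
    refine ⟨Icc 1 N, by rw [Nat.card_Icc]; omega, Subset.rfl, ?_⟩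
    rw [sum_padicValNat_eq hIcc]
    refine sum_congr rfl fun e _ => ?_
    rw [card_filter_Icc_dvd, min_eq_right ((Nat.div_le_self _ _).trans hNa)]
  · push Not at hNa
    -- the least `E` with `⌊N/p^E⌋ ≤ a`; `E ≥ 1` since `⌊N/p^0⌋ = N > a`
    have hex : ∃ e : ℕ, N / p ^ e ≤ a :=
      ⟨N, by rw [Nat.div_eq_of_lt (Nat.lt_pow_self hp1)]; exact Nat.zero_le _⟩
    classical
    set E := Nat.find hex with hE_def
    have hE : N / p ^ E ≤ a := Nat.find_spec hex
    have hEmin : ∀ e, e < E → a < N / p ^ e := fun e he =>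
      not_le.1 (Nat.find_min hex he)
    have hE0 : E ≠ 0 := by
      intro h
      have := hE
      rw [h, pow_zero, Nat.div_one] at this
      omega
    obtain ⟨F, hF⟩ : ∃ F, E = F + 1 := Nat.exists_eq_succ_of_ne_zero hE0
    have hFa : a < N / p ^ F := hEmin F (by omega)
    have hF1a : N / p ^ (F + 1) ≤ a := hF ▸ hE
    -- `A` = multiples of `p^(F+1)` in `[1, N]`, `B` = integers of valuation exactly `F`
    set A := (Icc 1 N).filter (fun x => p ^ (F + 1) ∣ x) with hA_def
    set PF := (Icc 1 N).filter (fun x => p ^ F ∣ x) with hPF_def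
    have hAPF : A ⊆ PF := by
      intro x hx
      rw [hA_def, mem_filter] at hx
      rw [hPF_def, mem_filter]
      exact ⟨hx.1, (pow_dvd_pow p (Nat.le_succ F)).trans hx.2⟩
    have hAcard : A.card = N / p ^ (F + 1) := card_filter_Icc_dvd N _
    have hPFcard : PF.card = N / p ^ F := card_filter_Icc_dvd N _
    have hBcard : a - N / p ^ (F + 1) ≤ (PF \ A).card := by
      rw [card_sdiff_of_subset hAPF, hAcard, hPFcard]
      omega
    obtain ⟨T, hTB, hTcard⟩ := exists_subset_card_eq hBcard
    have hdisj : Disjoint A T := by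
      rw [Finset.disjoint_left]
      intro x hxA hxT
      exact (mem_sdiff.1 (hTB hxT)).2 hxA
    have hS_sub : A ∪ T ⊆ Icc 1 N := by
      refine union_subset (filter_subset _ _) (hTB.trans ?_)
      exact (sdiff_subset).trans (filter_subset _ _)
    have hScard : (A ∪ T).card = a := by
      rw [card_union_of_disjoint hdisj, hAcard, hTcard]
      omega
    refine ⟨A ∪ T, hScard.le, hS_sub, ?_⟩
    rw [sum_padicValNat_eq fun x hx => hIcc x (hS_sub hx)]
    refine sum_congr rfl fun e he => ?_
    have he1 := (mem_Icc.1 he).1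
    by_cases heF : e ≤ F
    · -- every element of `S` is a multiple of `p^F`, hence of `p^e`; and `⌊N/p^e⌋ > a`
      have hall : (A ∪ T).filter (fun x => p ^ e ∣ x) = A ∪ T := by
        refine filter_true_of_mem fun x hx => ?_
        have hxPF : x ∈ PF := by
          rcases mem_union.1 hx with hxA | hxT
          · exact hAPF hxA
          · exact (mem_sdiff.1 (hTB hxT)).1
        exact (pow_dvd_pow p heF).trans (mem_filter.1 hxPF).2
      have hme : a < N / p ^ e :=
        hFa.trans_le (Nat.div_le_div_left (Nat.pow_le_pow_right hp.out.pos heF) (Nat.pow_pos hp.out.pos))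
      rw [hall, hScard, min_eq_left hme.le]
    · -- `e ≥ F + 1`: the multiples of `p^e` in `S` are all the multiples of `p^e` in `[1, N]`
      push Not at heF
      have hsame : (A ∪ T).filter (fun x => p ^ e ∣ x) = (Icc 1 N).filter (fun x => p ^ e ∣ x) := by
        ext x
        simp only [mem_filter, mem_union]
        constructor
        · rintro ⟨hx, hdvd⟩
          exact ⟨hS_sub (mem_union.2 hx), hdvd⟩
        · rintro ⟨hx, hdvd⟩
          refine ⟨Or.inl ?_, hdvd⟩
          rw [hA_def, mem_filter]
          exact ⟨hx, (pow_dvd_pow p (by omega : F + 1 ≤ e)).trans hdvd⟩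
      have hme : N / p ^ e ≤ a :=
        (Nat.div_le_div_left (Nat.pow_le_pow_right hp.out.pos (by omega : F + 1 ≤ e))
          (Nat.pow_pos hp.out.pos)).trans hF1a
      rw [hsame, card_filter_Icc_dvd, min_eq_right hme]

/-- **Fischler 2026, Lemma 2 — sharpness.** For every prime `p` some admissible product (of at most
`a` distinct integers of `[1, N]`) has `p`-adic valuation exactly `v_p(Δ_{a,N})`.
[cite: Fischler2026, §3.3 proof of Lemma 2, step "Δ divides Δ_{a,N}" (arXiv p. 8)] -/
theorem exists_prod_padicValNat_eq (p : ℕ) [hp : Fact p.Prime] (a N : ℕ) :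
    ∃ S : Finset ℤ, S.card ≤ a ∧ (∀ x ∈ S, 1 ≤ x ∧ x ≤ (N : ℤ)) ∧
      padicValNat p (∏ x ∈ S, x).natAbs = padicValNat p (Delta a N) := by
  obtain ⟨S, hcard, hsub, hsum⟩ := exists_sum_padicValNat_eq p a N
  refine ⟨S.map (Nat.castEmbedding (R := ℤ)), by rwa [card_map], fun x hx => ?_, ?_⟩
  · obtain ⟨y, hy, rfl⟩ := mem_map.1 hx
    have := mem_Icc.1 (hsub hy)
    simp only [Nat.castEmbedding_apply]
    exact ⟨by exact_mod_cast this.1, by exact_mod_cast this.2⟩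
  · have hS0 : ∀ x ∈ S.map (Nat.castEmbedding (R := ℤ)), x ≠ 0 := by
      intro x hx
      obtain ⟨y, hy, rfl⟩ := mem_map.1 hx
      have := (mem_Icc.1 (hsub hy)).1
      simp only [Nat.castEmbedding_apply, ne_eq, Nat.cast_eq_zero]
      omega
    rw [padicValNat_natAbs_prod hS0, sum_map, padicValNat_Delta]
    simp only [Nat.castEmbedding_apply, Int.natAbs_natCast]
    exact hsum

/-- **Fischler 2026, Lemma 2 — `Δ_{a,N}` is the LEAST common multiple.** Any non-zero integer divisible
by every admissible product (at most `a` pairwise distinct non-zero integers of `[-N, N]` with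
spread `≤ N`) is divisible by `Δ_{a,N}`; together with `prod_dvd_Delta`, `Delta a N` is the printed
`Δ_{a,N} = lcm{N₁⋯N_ℓ}`. [cite: Fischler2026, §3.3 Lemma 2 ("equality holds: Δ = Δ_{a,N}", arXiv p. 8)] -/
theorem Delta_dvd_of_forall_prod_dvd {a N : ℕ} {M : ℤ} (hM : M ≠ 0)
    (h : ∀ S : Finset ℤ, S.card ≤ a → (0 : ℤ) ∉ S → (∀ x ∈ S, |x| ≤ (N : ℤ)) →
      (∀ x ∈ S, ∀ y ∈ S, x - y ≤ (N : ℤ)) → (∏ x ∈ S, x) ∣ M) :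
    (Delta a N : ℤ) ∣ M := by
  rw [Int.natCast_dvd]
  refine (Nat.factorization_prime_le_iff_dvd (Delta_ne_zero a N) (Int.natAbs_ne_zero.2 hM)).1
    fun p hp => ?_
  haveI := Fact.mk hp
  obtain ⟨S, hcard, hS, hval⟩ := exists_prod_padicValNat_eq p a N
  have hS0 : ∀ x ∈ S, x ≠ 0 := fun x hx => by have := (hS x hx).1; omega
  have hdvd : (∏ x ∈ S, x) ∣ M :=
    h S hcard (fun h0 => hS0 0 h0 rfl) (fun x hx => by
        have := hS x hx
        rw [abs_of_pos (by omega)]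
        exact this.2)
      (fun x hx y hy => by have := hS x hx; have := hS y hy; omega)
  have hP0 : (∏ x ∈ S, x).natAbs ≠ 0 := Int.natAbs_ne_zero.2 (prod_ne_zero_iff.2 hS0)
  have hle := (Finsupp.le_def.1 ((Nat.factorization_le_iff_dvd hP0 (Int.natAbs_ne_zero.2 hM)).2
    (Int.natAbs_dvd_natAbs.2 hdvd))) p
  rw [Nat.factorization_def _ hp, Nat.factorization_def _ hp] at hle
  rw [Nat.factorization_def _ hp, Nat.factorization_def _ hp, ← hval]
  exact hle

/-! ### Asymptotics -/

/-- `(log d_{⌊N/k⌋})/N → 1/k` for `k ≥ 1`, i.e. `ψ(N/k) = (N/k)(1 + o(1))` (prime number theorem,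
`(log d_M)/M → 1`). [cite: Fischler2026, §3.3 proof of Lemma 2 ("the prime number theorem yields
ψ(N) = N(1+o(1))", applied at `N/k`, arXiv p. 8)] -/
theorem tendsto_log_lcmUpto_div_div {k : ℕ} (hk : 0 < k) :
    Tendsto (fun N : ℕ => Real.log (Nat.lcmUpto (N / k)) / N) atTop (𝓝 (1 / k : ℝ)) := by
  -- `⌊N/k⌋ → ∞`
  have hdiv : Tendsto (fun N : ℕ => N / k) atTop atTop := by
    refine tendsto_atTop_atTop.2 fun b => ⟨b * k, fun N hN => ?_⟩
    exact (Nat.le_div_iff_mul_le hk).2 hN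
  -- `(log d_m)/m → 1` along `m = ⌊N/k⌋`
  have h1 : Tendsto (fun N : ℕ => Real.log (Nat.lcmUpto (N / k)) / ((N / k : ℕ) : ℝ)) atTop (𝓝 1) :=
    Literature.NumberTheory.Transcendental.tendsto_log_lcmUpto_div.comp hdiv
  -- `⌊N/k⌋/N → 1/k`
  have h2 : Tendsto (fun N : ℕ => ((N / k : ℕ) : ℝ) / N) atTop (𝓝 (1 / k : ℝ)) := by
    have h := (tendsto_nat_floor_mul_div_atTop (R := ℝ) (a := 1 / k) (by positivity)).comp
      tendsto_natCast_atTop_atTop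
    refine h.congr' (Eventually.of_forall fun N => ?_)
    simp only [Function.comp_apply]
    rw [one_div_mul_eq_div, Nat.floor_div_eq_div]
  have h3 := h1.mul h2
  rw [one_mul] at h3
  refine h3.congr' ?_
  filter_upwards [eventually_ge_atTop k] with N hN
  have hm : ((N / k : ℕ) : ℝ) ≠ 0 := by
    have : 0 < N / k := Nat.div_pos hN hk
    positivity
  have hN0 : (N : ℝ) ≠ 0 := by
    have : 0 < N := hk.trans_le hN
    positivity
  field_simp

/-- **Fischler 2026, Lemma 2 — asymptotics.** `(1/N) log Δ_{a,N} → ∑_{k=1}^a 1/k` as `N → ∞`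
(`Δ_{a,N} = exp(N(∑_{j=1}^a 1/j + o(1)))`, versus `a` for the naive `d_N^a`).
[cite: Fischler2026, §3.3 Lemma 2 and proof (arXiv p. 8: `log Δ = ∑_{k=1}^a ψ(N/k)`)] -/
theorem tendsto_log_Delta_div (a : ℕ) :
    Tendsto (fun N : ℕ => Real.log (Delta a N) / N) atTop (𝓝 (∑ k ∈ Icc 1 a, (1 / k : ℝ))) := by
  have h : ∀ N : ℕ, Real.log (Delta a N) / N =
      ∑ k ∈ Icc 1 a, Real.log (Nat.lcmUpto (N / k)) / N := by
    intro N
    unfold Delta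
    rw [Nat.cast_prod, Real.log_prod, sum_div]
    intro k _
    exact_mod_cast (Nat.lcmUpto_pos _).ne'
  simp_rw [h]
  exact tendsto_finsetSum _ fun k hk => tendsto_log_lcmUpto_div_div (mem_Icc.1 hk).1

/-- Transcription check: `Δ_{2,4} = d_4 · d_2 = 12 · 2 = 24`; as the printed lcm: `2³` from the
admissible product `2 · 4` (spread `2 ≤ 4`), `3` from `{3}`, and no admissible product of two distinct
non-zero integers of `[-4, 4]` with spread `≤ 4` is divisible by `16` or by `9`.
[cite: Fischler2026, §3.3 Lemma 2] -/
theorem Delta_two_four : Delta 2 4 = 24 := by decide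

end Literature.NumberTheory.Irrationality.Fischler2026
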